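/-
Copyright (c) 2026. All rights reserved.
Released under Apache 2.0 license as described in the file LICENSE.
-/
import Literature.NumberTheory.Automorphic.RealMatrixGroupCharacterSmooth
import Literature.RepresentationTheory.KonnoKonno2007.JunctionArchDifferentiable
import Literature.RepresentationTheory.KonnoKonno2007.JunctionVacuumTwist
import HarnessLib

/-!
# Smoothness of an archimedean Weil datum along `U(2,1)` survives a continuous character twist

Topic `RepresentationTheory/KonnoKonno2007` (companion of `JunctionArchDifferentiable` = AN-D). AN-D proves: for an
archimedean Weil datum `ω` of `G_∞ = U(2,1) × U(R,S)` (`IsArchWeilDatum (ι𝕎 (Fin 2) Unit R S) ω`) WITH THE VACUUM CLAUSE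
`ω (κ k) h₀ = vacScalar e k • h₀` (`e : VacExponents`), every `x ↦ T (ω (c x, 1) Φ)` is `C^∞` (`c` smooth into `U(2,1)`,
`T` continuous real-linear), in particular in the exponential `𝔭`-coordinates `b ↦ u21FrameEquiv (y · expP b)` of the
ball. Two archimedean Weil data over the same symplectic action differ by a continuous character
(`IsArchWeilDatum.exists_continuous_character`), and the twisted datum `charTwist χ ω`
(`Weil1964.charTwist`, `IsArchWeilDatum.twist`) has vacuum character `χ ∘ κ · vacScalar e`, which is in general NOT
of the form `vacScalar e'` — so AN-D does not apply to it verbatim. This file closes the gap: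

* `contDiffAt_character_inl / _ball / _mul_expP`, `contDiff_character_expP` — a CONTINUOUS character
  `χ : G_∞ →* ℂ` is `C^∞` along `U(2,1)` in all four shapes of AN-D (É. Cartan for characters, from the tree's
  `RealMatrixGroup.contDiffAt_character_of_continuous` with the `𝔲(2,1)` basis `u21X` and `uFormGroup_regular`);
* `contDiffAt_charTwist_inl / _ball / _mul_expP`, `differentiableAt_charTwist_mul_expP`, `contDiff_charTwist_expP`,
  `differentiableAt_charTwist_expP` — AN-D's six conclusions for the twisted datum `charTwist χ ω`, from AN-D for `ω`
  and `T (χ • v) = (Re χ) T v + (Im χ) T (I • v)` (`contDiffAt_smul_of_forall`).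

Consumer: the (T-j) factorisation `IsArchWeilDatum.exists_twist_factorisation` (`Weil1964/ArchWeilDatumFactorisation`)
produces the `ι₁`-factor of a big archimedean datum as a twist `χ • ω₁` of a chosen small datum `ω₁` (for which the
vacuum clause is available, e.g. `JunctionLinearWeilDatum`) by the continuous block character `χ`; with this file the
differentiability sockets of the model layer apply to `χ • ω₁`. Kernel-proved; no records, no named facts.

## References

* V. S. Varadarajan, *Lie Groups, Lie Algebras, and Their Representations*, GTM 102 (1984), Thm. 2.10.1, (2.10.19),
  Thm. 2.11.2. [Varadarajan1984]
-/

noncomputable section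

open scoped MatrixGroups Matrix Topology SchwartzMap Matrix.Norms.Operator
open Filter
open Literature.NumberTheory.Automorphic Literature.Analysis.SegalBargmann Literature.NumberTheory.Weil1964

namespace Literature.RepresentationTheory.KonnoKonno2007

namespace RealDualPair

section Main

variable {R S : Type*} [Fintype R] [DecidableEq R] [Fintype S] [DecidableEq S]
  {V : Type*} [NormedAddCommGroup V] [NormedSpace ℝ V]

local notation "SR21" => SchwartzMap (DPIdx (Fin 2) Unit R S → ℝ) ℂ
local notation "G21" => Ginf (Fin 2) Unit R S

/-! ## 1. A continuous character is smooth along `U(2,1)` -/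

set_option backward.isDefEq.respectTransparency false in
/-- **A continuous character of `U(2,1) × U(R,S)` is `C^∞` along `U(2,1)`**: for `c : B → U(2,1)` smooth at `x₀`
as a matrix-valued map, `x ↦ χ (c x, 1)` is `C^∞` at `x₀`. [cite: Varadarajan1984, Thm. 2.11.2, p. 138] -/
theorem contDiffAt_character_inl {χ : G21 →* ℂ} (hχ : Continuous χ)
    {B : Type*} [NormedAddCommGroup B] [NormedSpace ℝ B] {c : B → UForm (Fin 2) Unit} {x₀ : B}
    (hc : ContDiffAt ℝ ((⊤ : ℕ∞) : WithTop ℕ∞) (fun x => ((c x : GL (Fin 2 ⊕ Unit) ℂ) : Matrix (Fin 2 ⊕ Unit) (Fin 2 ⊕ Unit) ℂ)) x₀) :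
    ContDiffAt ℝ ((⊤ : ℕ∞) : WithTop ℕ∞) (fun x => χ ((c x, (1 : UForm R S)) : G21)) x₀ :=
  (uFormGroup (Fin 2) Unit).contDiffAt_character_of_continuous uFormGroup_regular u21X u21AdaptedBasis
    (fun _ => rfl) (χ := χ.comp (MonoidHom.inl (UForm (Fin 2) Unit) (UForm R S)))
    (hχ.comp (continuous_id.prodMk continuous_const)) hc

open Literature.Geometry.ComplexHyperbolic.BallModel Literature.AlgebraicGeometry.ShimuraVarieties.BallForms

set_option backward.isDefEq.respectTransparency false in
/-- Reindexing `Matrix (Fin 3) → Matrix (Fin 2 ⊕ Unit)` along the frame is `C^∞` (a continuous linear map in finite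
dimension). [folklore] -/
theorem contDiff_reindex_frameIdx :
    ContDiff ℝ ((⊤ : ℕ∞) : WithTop ℕ∞) fun M : Matrix (Fin 3) (Fin 3) ℂ => Matrix.reindex frameIdx frameIdx M := by
  let L : Matrix (Fin 3) (Fin 3) ℂ →ₗ[ℝ] Matrix (Fin 2 ⊕ Unit) (Fin 2 ⊕ Unit) ℂ :=
    (Matrix.reindexLinearEquiv ℝ ℂ frameIdx frameIdx).toLinearMap
  have hLc : Continuous L := L.continuous_of_finiteDimensional
  have hco : ⇑(⟨L, hLc⟩ : Matrix (Fin 3) (Fin 3) ℂ →L[ℝ] Matrix (Fin 2 ⊕ Unit) (Fin 2 ⊕ Unit) ℂ) =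
      fun M => Matrix.reindex frameIdx frameIdx M := rfl
  rw [← hco]
  exact ContinuousLinearMap.contDiff _

set_option backward.isDefEq.respectTransparency false in
/-- If `c : B → U21` is `C^∞` at `x₀` as a `3 × 3`-matrix-valued map, so is `u21FrameEquiv ∘ c` as a
`(Fin 2 ⊕ Unit)`-matrix-valued map. [folklore] -/
theorem contDiffAt_coe_u21FrameEquiv {B : Type*} [NormedAddCommGroup B] [NormedSpace ℝ B] {c : B → U21} {x₀ : B}
    (hc : ContDiffAt ℝ ((⊤ : ℕ∞) : WithTop ℕ∞) (fun x => mat (c x)) x₀) :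
    ContDiffAt ℝ ((⊤ : ℕ∞) : WithTop ℕ∞) (fun x => (((u21FrameEquiv (c x) : UForm (Fin 2) Unit) : GL (Fin 2 ⊕ Unit) ℂ) :
      Matrix (Fin 2 ⊕ Unit) (Fin 2 ⊕ Unit) ℂ)) x₀ := by
  have hfun : (fun x => (((u21FrameEquiv (c x) : UForm (Fin 2) Unit) : GL (Fin 2 ⊕ Unit) ℂ) :
      Matrix (Fin 2 ⊕ Unit) (Fin 2 ⊕ Unit) ℂ)) = fun x => Matrix.reindex frameIdx frameIdx (mat (c x)) :=
    funext fun x => coe_u21FrameEquiv (c x)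
  rw [hfun]
  exact contDiff_reindex_frameIdx.contDiffAt.comp x₀ hc

set_option backward.isDefEq.respectTransparency false in
/-- `b ↦ mat (y · expP b)` is `C^∞`. [folklore] -/
theorem contDiffAt_mat_mul_expP (y : U21) (b₀ : Fin 2 → ℂ) :
    ContDiffAt ℝ ((⊤ : ℕ∞) : WithTop ℕ∞) (fun b : Fin 2 → ℂ => mat (y * expP b)) b₀ := by
  have hfun : (fun b : Fin 2 → ℂ => mat (y * expP b)) = fun b => mat y * NormedSpace.exp (pMatL b) := by
    funext b
    rw [mat_mul, mat_expP, pMatL_apply]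
  rw [hfun]
  exact contDiffAt_const.mul
    ((NormedSpace.exp_analytic (𝕂 := ℝ) (pMatL b₀)).contDiffAt.comp b₀ pMatL.contDiff.contDiffAt)

set_option backward.isDefEq.respectTransparency false in
/-- **Ball-model form**: `x ↦ χ (u21FrameEquiv (c x), 1)` is `C^∞` at `x₀` for `c : B → U21` smooth at `x₀`.
[cite: Varadarajan1984, Thm. 2.11.2, p. 138] -/
theorem contDiffAt_character_ball {χ : G21 →* ℂ} (hχ : Continuous χ)
    {B : Type*} [NormedAddCommGroup B] [NormedSpace ℝ B] {c : B → U21} {x₀ : B}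
    (hc : ContDiffAt ℝ ((⊤ : ℕ∞) : WithTop ℕ∞) (fun x => mat (c x)) x₀) :
    ContDiffAt ℝ ((⊤ : ℕ∞) : WithTop ℕ∞) (fun x => χ ((u21FrameEquiv (c x), (1 : UForm R S)) : G21)) x₀ :=
  contDiffAt_character_inl hχ (contDiffAt_coe_u21FrameEquiv hc)

set_option backward.isDefEq.respectTransparency false in
/-- **Exponential `𝔭`-coordinates**: `b ↦ χ (u21FrameEquiv (y · expP b), 1)` is `C^∞` at every `b₀`.
[cite: Varadarajan1984, Thm. 2.11.2, p. 138] -/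
theorem contDiffAt_character_mul_expP {χ : G21 →* ℂ} (hχ : Continuous χ) (y : U21) (b₀ : Fin 2 → ℂ) :
    ContDiffAt ℝ ((⊤ : ℕ∞) : WithTop ℕ∞) (fun b : Fin 2 → ℂ => χ ((u21FrameEquiv (y * expP b), (1 : UForm R S)) : G21)) b₀ :=
  contDiffAt_character_ball hχ (contDiffAt_mat_mul_expP y b₀)

set_option backward.isDefEq.respectTransparency false in
/-- **`y`-free, global**: `b ↦ χ (u21FrameEquiv (expP b), 1)` is `C^∞` on `ℂ²`. [cite: Varadarajan1984, Thm. 2.11.2, p. 138] -/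
theorem contDiff_character_expP {χ : G21 →* ℂ} (hχ : Continuous χ) :
    ContDiff ℝ ((⊤ : ℕ∞) : WithTop ℕ∞) fun b : Fin 2 → ℂ => χ ((u21FrameEquiv (expP b), (1 : UForm R S)) : G21) := by
  refine contDiff_iff_contDiffAt.2 fun b₀ => ?_
  have h := contDiffAt_character_mul_expP (R := R) (S := S) hχ 1 b₀
  simp only [one_mul] at h
  exact h

/-! ## 2. AN-D for the twisted datum `charTwist χ ω` -/

set_option backward.isDefEq.respectTransparency false in
/-- **AN-D under a character twist, `inl` form.** For an archimedean Weil datum `ω` of `U(2,1) × U(R,S)` with vacuum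
clause and a continuous character `χ` of `G_∞`, every `x ↦ T (charTwist χ ω (c x, 1) Φ)` is `C^∞` at `x₀`
(`c` smooth at `x₀` into `U(2,1)`, `T` continuous real-linear). [cite: Varadarajan1984, Thm. 2.10.1 and (2.10.19), p. 89] -/
theorem contDiffAt_charTwist_inl {ω : Representation ℂ G21 SR21}
    (hW : IsArchWeilDatum (ι𝕎 (Fin 2) Unit R S) ω) {e : VacExponents}
    (hvac : ∀ k : DPK (Fin 2) Unit R S, ω (κ (Fin 2) Unit R S k) (hermitePi 0) = vacScalar e k • hermitePi 0)
    {χ : G21 →* ℂ} (hχ : Continuous χ)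
    {B : Type*} [NormedAddCommGroup B] [NormedSpace ℝ B] {c : B → UForm (Fin 2) Unit} {x₀ : B}
    (hc : ContDiffAt ℝ ((⊤ : ℕ∞) : WithTop ℕ∞) (fun x => ((c x : GL (Fin 2 ⊕ Unit) ℂ) : Matrix (Fin 2 ⊕ Unit) (Fin 2 ⊕ Unit) ℂ)) x₀)
    (T : SR21 →L[ℝ] V) (Φ : SR21) :
    ContDiffAt ℝ ((⊤ : ℕ∞) : WithTop ℕ∞) (fun x => T (charTwist χ ω ((c x, (1 : UForm R S)) : G21) Φ)) x₀ := by
  simp only [charTwist_apply]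
  exact contDiffAt_smul_of_forall (contDiffAt_character_inl hχ hc)
    (fun T' => contDiffAt_weilDatum_inl hW hvac hc T' Φ) T

set_option backward.isDefEq.respectTransparency false in
/-- **AN-D under a character twist, ball form.** [folklore] -/
theorem contDiffAt_charTwist_ball {ω : Representation ℂ G21 SR21}
    (hW : IsArchWeilDatum (ι𝕎 (Fin 2) Unit R S) ω) {e : VacExponents}
    (hvac : ∀ k : DPK (Fin 2) Unit R S, ω (κ (Fin 2) Unit R S k) (hermitePi 0) = vacScalar e k • hermitePi 0)
    {χ : G21 →* ℂ} (hχ : Continuous χ)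
    {B : Type*} [NormedAddCommGroup B] [NormedSpace ℝ B] {c : B → U21} {x₀ : B}
    (hc : ContDiffAt ℝ ((⊤ : ℕ∞) : WithTop ℕ∞) (fun x => mat (c x)) x₀) (T : SR21 →L[ℝ] V) (Φ : SR21) :
    ContDiffAt ℝ ((⊤ : ℕ∞) : WithTop ℕ∞) (fun x => T (charTwist χ ω ((u21FrameEquiv (c x), (1 : UForm R S)) : G21) Φ)) x₀ :=
  contDiffAt_charTwist_inl hW hvac hχ (contDiffAt_coe_u21FrameEquiv hc) T Φ

set_option backward.isDefEq.respectTransparency false in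
/-- **AN-D under a character twist, exponential `𝔭`-coordinates.** [folklore] -/
theorem contDiffAt_charTwist_mul_expP {ω : Representation ℂ G21 SR21}
    (hW : IsArchWeilDatum (ι𝕎 (Fin 2) Unit R S) ω) {e : VacExponents}
    (hvac : ∀ k : DPK (Fin 2) Unit R S, ω (κ (Fin 2) Unit R S k) (hermitePi 0) = vacScalar e k • hermitePi 0)
    {χ : G21 →* ℂ} (hχ : Continuous χ) (y : U21) (T : SR21 →L[ℝ] V) (Φ : SR21) (b₀ : Fin 2 → ℂ) :
    ContDiffAt ℝ ((⊤ : ℕ∞) : WithTop ℕ∞)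
      (fun b : Fin 2 → ℂ => T (charTwist χ ω ((u21FrameEquiv (y * expP b), (1 : UForm R S)) : G21) Φ)) b₀ :=
  contDiffAt_charTwist_ball hW hvac hχ (contDiffAt_mat_mul_expP y b₀) T Φ

set_option backward.isDefEq.respectTransparency false in
/-- **… hence real-Fréchet-differentiable there** (the `hd` input of `UnitaryBallHolomorphyCriterion`). [folklore] -/
theorem differentiableAt_charTwist_mul_expP {ω : Representation ℂ G21 SR21}
    (hW : IsArchWeilDatum (ι𝕎 (Fin 2) Unit R S) ω) {e : VacExponents}
    (hvac : ∀ k : DPK (Fin 2) Unit R S, ω (κ (Fin 2) Unit R S k) (hermitePi 0) = vacScalar e k • hermitePi 0)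
    {χ : G21 →* ℂ} (hχ : Continuous χ) (y : U21) (T : SR21 →L[ℝ] V) (Φ : SR21) (b₀ : Fin 2 → ℂ) :
    DifferentiableAt ℝ
      (fun b : Fin 2 → ℂ => T (charTwist χ ω ((u21FrameEquiv (y * expP b), (1 : UForm R S)) : G21) Φ)) b₀ :=
  (contDiffAt_charTwist_mul_expP hW hvac hχ y T Φ b₀).differentiableAt (by simp)

set_option backward.isDefEq.respectTransparency false in
/-- **Consumer shape, `y`-free, global** (the model layer's `IsWeaklyPDiff` binder at the pin `e = expP`, for the
twisted datum). [folklore] -/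
theorem contDiff_charTwist_expP {ω : Representation ℂ G21 SR21}
    (hW : IsArchWeilDatum (ι𝕎 (Fin 2) Unit R S) ω) {e : VacExponents}
    (hvac : ∀ k : DPK (Fin 2) Unit R S, ω (κ (Fin 2) Unit R S k) (hermitePi 0) = vacScalar e k • hermitePi 0)
    {χ : G21 →* ℂ} (hχ : Continuous χ) (T : SR21 →L[ℝ] V) (Φ : SR21) :
    ContDiff ℝ ((⊤ : ℕ∞) : WithTop ℕ∞)
      (fun b : Fin 2 → ℂ => T (charTwist χ ω ((u21FrameEquiv (expP b), (1 : UForm R S)) : G21) Φ)) := by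
  refine contDiff_iff_contDiffAt.2 fun b₀ => ?_
  have h := contDiffAt_charTwist_mul_expP hW hvac hχ 1 T Φ b₀
  simp only [one_mul] at h
  exact h

set_option backward.isDefEq.respectTransparency false in
/-- **Consumer shape, `y`-free, first order.** [folklore] -/
theorem differentiableAt_charTwist_expP {ω : Representation ℂ G21 SR21}
    (hW : IsArchWeilDatum (ι𝕎 (Fin 2) Unit R S) ω) {e : VacExponents}
    (hvac : ∀ k : DPK (Fin 2) Unit R S, ω (κ (Fin 2) Unit R S k) (hermitePi 0) = vacScalar e k • hermitePi 0)
    {χ : G21 →* ℂ} (hχ : Continuous χ) (T : SR21 →L[ℝ] V) (Φ : SR21) (b₀ : Fin 2 → ℂ) :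
    DifferentiableAt ℝ
      (fun b : Fin 2 → ℂ => T (charTwist χ ω ((u21FrameEquiv (expP b), (1 : UForm R S)) : G21) Φ)) b₀ :=
  (contDiff_charTwist_expP hW hvac hχ T Φ).contDiffAt.differentiableAt (by simp)

end Main

end RealDualPair

end Literature.RepresentationTheory.KonnoKonno2007
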